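import Literature.Analysis.FluidPDE.KNSSTypeIIZoomIn
import Literature.Analysis.FluidPDE.BoundedL2ClassicalMild
import Literature.Analysis.FluidPDE.OseenDuhamelLimits
import HarnessLib

/-!
# Route PlaneEnergyCeiling · crux `BoundedPlanarEnergyRegularity` — zoom stub, step 4:
# the pointwise limit of the finite-energy zoom satisfies the Oseen integral equation

Helper file for the crux item stmt-NavierStokesRegularity-16921 (`BoundedPlanarEnergyRegularity`),
serving the zoom stub `stub_planarEnergyZoom` (= support item stmt-NavierStokesRegularity-16858) of
its line `birth`. KNSS 2009, Lemma 6.1 (arXiv:0709.3599 p. 11: "the `u_l` converge locally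
uniformly … to an ancient MILD solution"), finite-energy version, for the pointwise limit produced
by `exists_zoom_limit_of_memLp_two`: each rescaled field `V_n(s,y) = c_n u(t_n + c_n² s, x_n + c_n y)`
is a classical solution on `(A_n, B_n)` (`A_n = −t_n/c_n² → −∞`, `B_n > 0`), bounded by `2` on
`(A_n, 0]` and with uniformly square-integrable slices there (the slices of `u` being uniformly in
`L²`), hence Oseen-mild on `(A_n, 0)` (`mild_of_bounded_of_eLpNorm_two_le_of_lt`: KNSS Lemma 3.1
with the parasitic drift killed by finite energy); the Oseen identity
`V_n(t) = e^{(t−s)Δ}V_n(s) − B¹_s(V_n,V_n)(t)` passes to the pointwise limit by dominated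
convergence in the caloric term (`tendsto_heatExtension_of_tendsto_of_bound`) and in the Duhamel
term (`tendsto_oseenDuhamel_of_tendsto_of_bound`). Result (`zoom_limit_oseen_identity`):
`v(t) = e^{(t−s)Δ}v(s) − B¹_s(v,v)(t)` pointwise for all `s < t < 0`.

References: Koch–Nadirashvili–Seregin–Šverák 2009, §3 Lemma 3.1, §4 (i), §6 Lemma 6.1
(arXiv:0709.3599). [KochNadirashviliSereginSverak2009]
-/

noncomputable section

-- single-conjunct summit: `Summit.<Summit>.<Problem>` repeats the name by the D-0017 layout
set_option linter.dupNamespace false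

namespace Summit.NavierStokesRegularity.NavierStokesRegularity.Theorems.BoundedPlanarEnergyRegularity

open MeasureTheory Set Function Filter Topology TopologicalSpace Metric
open scoped NNReal ENNReal
open Literature.Analysis Literature.Analysis.FluidPDE

/-- **`L²` norms of rescaled slices**: `‖c • w(x₀ + c ·)‖_{L²(ℝ³)} = c · (c⁻³)^{1/2} ‖w‖_{L²}` for
`c > 0` (push-forward of Lebesgue measure under the affine map, `map_space_affine_volume`). -/
theorem eLpNorm_two_zoom_slice (w : EuclideanSpace ℝ (Fin 3) → EuclideanSpace ℝ (Fin 3))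
    (x₀ : EuclideanSpace ℝ (Fin 3)) {c : ℝ} (hc : 0 < c) :
    eLpNorm (fun y => c • w (x₀ + c • y)) 2 volume =
      ENNReal.ofReal c * (ENNReal.ofReal ((c ^ 3)⁻¹) ^ (1 / (2 : ℝ≥0∞)).toReal * eLpNorm w 2 volume) := by
  set e := spaceAffineHomeomorph hc.ne' x₀ with he
  have hme : MeasurableEmbedding e := e.measurableEmbedding
  have hcoe : (e : EuclideanSpace ℝ (Fin 3) → EuclideanSpace ℝ (Fin 3)) = fun y => x₀ + c • y := rfl
  have h2 := hme.eLpNorm_map_measure (g := w) (p := 2)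
    (μ := (volume : Measure (EuclideanSpace ℝ (Fin 3))))
  rw [hcoe, map_space_affine_volume hc x₀, finrank_euclideanSpace_fin,
    eLpNorm_smul_measure_of_ne_top ENNReal.ofNat_ne_top, smul_eq_mul] at h2
  have h3 : eLpNorm (fun y => w (x₀ + c • y)) 2 volume =
      ENNReal.ofReal ((c ^ 3)⁻¹) ^ (1 / (2 : ℝ≥0∞)).toReal * eLpNorm w 2 volume := by
    rw [show (fun y => w (x₀ + c • y)) = w ∘ fun y => x₀ + c • y from rfl, ← h2]
  have h4 : (fun y => c • w (x₀ + c • y)) = c • fun y => w (x₀ + c • y) := rfl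
  rw [h4, eLpNorm_const_smul, h3, Real.enorm_eq_ofReal hc.le]

/-- **The pointwise limit of the finite-energy zoom satisfies the Oseen integral equation**
(KNSS 2009, Lemma 6.1, finite-energy version; module docstring): with the data of
`exists_zoom_limit_of_memLp_two` — `(u,p)` classical (`ν = 1`) on `(0,T) × ℝ³` with
`‖u(t)‖_{L²} ≤ K₀ < ∞`, near-record times `t_n ∈ (0,T)`, scales `c_n > 0` with `−t_n/c_n² → −∞`,
rescaled velocities bounded by `2` on `(−t_n/c_n², 0]` converging pointwise on `(−∞,0] × ℝ³` to a
continuous `v` — the limit satisfies `v(t) = e^{(t−s)Δ}v(s) − B¹_s(v,v)(t)` pointwise for all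
`s < t < 0`. -/
theorem zoom_limit_oseen_identity :
    ∀ (T : ℝ) (u : ℝ → EuclideanSpace ℝ (Fin 3) → EuclideanSpace ℝ (Fin 3))
      (p : ℝ → EuclideanSpace ℝ (Fin 3) → ℝ), 0 < T →
      Literature.Analysis.FluidPDE.IsClassicalNSSolutionOn (Set.Ioo 0 T) 1 0 u p →
      ∀ (K₀ : ENNReal), K₀ ≠ ⊤ →
      (∀ t ∈ Set.Ioo 0 T, MeasureTheory.eLpNorm (u t) 2 MeasureTheory.volume ≤ K₀) →
      ∀ (v : ℝ → EuclideanSpace ℝ (Fin 3) → EuclideanSpace ℝ (Fin 3)) (tn : ℕ → ℝ)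
        (xn : ℕ → EuclideanSpace ℝ (Fin 3)) (c : ℕ → ℝ),
        (∀ n, tn n ∈ Set.Ioo 0 T) → (∀ n, 0 < c n) →
        Filter.Tendsto (fun n => -(tn n / c n ^ 2)) Filter.atTop Filter.atBot →
        (∀ n, ∀ s ∈ Set.Ioc (-(tn n / c n ^ 2)) 0, ∀ y,
          ‖(c n • Literature.Analysis.FluidPDE.stPull (c n ^ 2) (c n) (tn n) (xn n) u) s y‖ ≤ 2) →
        (∀ t ≤ 0, ∀ x, Filter.Tendsto
          (fun n => (c n • Literature.Analysis.FluidPDE.stPull (c n ^ 2) (c n) (tn n) (xn n) u) t x)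
          Filter.atTop (nhds (v t x))) →
        Continuous (Function.uncurry v) →
        ∀ (s t : ℝ) (x : EuclideanSpace ℝ (Fin 3)), s < t → t < 0 →
          v t x = Literature.Analysis.UnboundedOperators.heatExtension (v s) (t - s) x -
            Literature.Analysis.FluidPDE.oseenDuhamel 1 s v v t x := by
  intro T u p hT h K₀ hK₀ hK₀b v tn xn c htn hcpos hAtend hVbd hVlim hvcont s t x hst ht0
  -- notation
  set A : ℕ → ℝ := fun n => -(tn n / c n ^ 2) with hAdef
  set B : ℕ → ℝ := fun n => (T - tn n) / c n ^ 2 with hBdef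
  set V : ℕ → ℝ → EuclideanSpace ℝ (Fin 3) → EuclideanSpace ℝ (Fin 3) :=
    fun n => c n • stPull (c n ^ 2) (c n) (tn n) (xn n) u with hVdef
  set P : ℕ → ℝ → EuclideanSpace ℝ (Fin 3) → ℝ :=
    fun n => c n ^ 2 • stPull (c n ^ 2) (c n) (tn n) (xn n) p with hPdef
  have hBpos : ∀ n, 0 < B n := fun n => div_pos (by linarith [(htn n).2]) (pow_pos (hcpos n) 2)
  have hVcl : ∀ n, IsClassicalNSSolutionOn (Ioo (A n) (B n)) 1 0 (V n) (P n) := fun n =>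
    (h.nsRescale_translate_zero (hcpos n) (tn n) (xn n)).mono
      (fun _ hs => zoom_time_mem (hcpos n).ne' hs) (uniqueDiffOn_Ioo _ _)
  have hVcont : ∀ n, ContinuousOn (uncurry (V n)) (Ioo (A n) (B n) ×ˢ univ) := fun n =>
    (hVcl n).smooth_velocity.continuousOn
  have hVslice : ∀ n, ∀ τ ∈ Ioo (A n) (B n), Continuous (V n τ) := fun n τ hτ =>
    ((hVcl n).contDiff_velocity hτ).continuous
  -- uniform `L²` bound of the slices of `V n` on `(A n, 0]` (scaling)
  have hVK : ∀ n, ∀ τ ∈ Ioc (A n) 0, eLpNorm (V n τ) 2 volume ≤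
      ENNReal.ofReal (c n) * (ENNReal.ofReal ((c n ^ 3)⁻¹) ^ (1 / (2 : ℝ≥0∞)).toReal * K₀) := by
    intro n τ hτ
    have hmem : tn n + c n ^ 2 * τ ∈ Ioo 0 T := by
      have h1 := zoom_time_mem_Ioc (t₀ := tn n) (hcpos n).ne' hτ
      exact ⟨h1.1, h1.2.trans_lt (htn n).2⟩
    have heq : V n τ = fun y => c n • u (tn n + c n ^ 2 * τ) (xn n + c n • y) := by
      funext y; simp only [hVdef, smul_stPull_apply]
    rw [heq, eLpNorm_two_zoom_slice _ _ (hcpos n)]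
    gcongr
    exact hK₀b _ hmem
  have hKtop : ∀ n, ENNReal.ofReal (c n) *
      (ENNReal.ofReal ((c n ^ 3)⁻¹) ^ (1 / (2 : ℝ≥0∞)).toReal * K₀) ≠ ∞ := fun n =>
    ENNReal.mul_ne_top ENNReal.ofReal_ne_top
      (ENNReal.mul_ne_top (ENNReal.rpow_ne_top_of_nonneg (by positivity) ENNReal.ofReal_ne_top) hK₀)
  -- the Oseen identity for `V n` between `s` and `t`, for all large `n`
  have hevA : ∀ᶠ n in atTop, A n < s := hAtend.eventually (eventually_lt_atBot s)
  obtain ⟨N, hN⟩ := eventually_atTop.1 hevA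
  have hmildV : ∀ n, N ≤ n →
      V n t x = UnboundedOperators.heatExtension (V n s) (t - s) x - oseenDuhamel 1 s (V n) (V n) t x :=
    fun n hn =>
      mild_of_bounded_of_eLpNorm_two_le_of_lt (hVcl n) ((hN n hn).trans (hst.trans ht0)) (hBpos n)
        (fun τ hτ y => hVbd n τ hτ y) (hKtop n) (fun τ hτ => hVK n τ hτ) (hN n hn) hst ht0 x
  -- the shifted sequence and its limits
  have hshift : ∀ {f : ℕ → EuclideanSpace ℝ (Fin 3)} {l : EuclideanSpace ℝ (Fin 3)},
      Tendsto f atTop (𝓝 l) → Tendsto (fun k => f (k + N)) atTop (𝓝 l) := fun hf =>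
    hf.comp (tendsto_add_atTop_nat N)
  have hAk : ∀ k, A (k + N) < s := fun k => hN (k + N) (Nat.le_add_left N k)
  -- (i) the left-hand side
  have hL : Tendsto (fun k => V (k + N) t x) atTop (𝓝 (v t x)) := hshift (hVlim t ht0.le x)
  -- (ii) the caloric term
  have hH : Tendsto (fun k => UnboundedOperators.heatExtension (V (k + N) s) (t - s) x) atTop
      (𝓝 (UnboundedOperators.heatExtension (v s) (t - s) x)) := by
    refine tendsto_heatExtension_of_tendsto_of_bound (M := 2) (fun k => ?_) (fun k z => ?_)
      (fun z => hshift (hVlim s (hst.trans ht0).le z)) (sub_pos.2 hst) x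
    · exact (hVslice (k + N) s ⟨hAk k, (hst.trans ht0).trans (hBpos _)⟩).aestronglyMeasurable
    · exact hVbd (k + N) s ⟨hAk k, (hst.trans ht0).le⟩ z
  -- (iii) the Duhamel term
  have hmeasV : ∀ k, AEStronglyMeasurable (uncurry (V (k + N)))
      ((volume : Measure (ℝ × EuclideanSpace ℝ (Fin 3))).restrict (Ioo s t ×ˢ univ)) := fun k =>
    ((hVcont (k + N)).mono (prod_mono (Ioo_subset_Ioo (hAk k).le (ht0.le.trans (hBpos _).le))
      Subset.rfl)).aestronglyMeasurable (measurableSet_Ioo.prod MeasurableSet.univ)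
  have hmeasv : AEStronglyMeasurable (uncurry v)
      ((volume : Measure (ℝ × EuclideanSpace ℝ (Fin 3))).restrict (Ioo s t ×ˢ univ)) :=
    hvcont.aestronglyMeasurable
  have hD : Tendsto (fun k => oseenDuhamel 1 s (V (k + N)) (V (k + N)) t x) atTop
      (𝓝 (oseenDuhamel 1 s v v t x)) :=
    tendsto_oseenDuhamel_of_tendsto_of_bound one_pos zero_le_two hst hmeasV hmeasv
      (fun k τ hτ y => hVbd (k + N) τ ⟨(hAk k).trans hτ.1, (hτ.2.trans ht0).le⟩ y)
      (fun τ hτ y => hshift (hVlim τ (hτ.2.trans ht0).le y)) x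
  -- conclusion: the two limits of the same sequence agree
  have hR : Tendsto (fun k => V (k + N) t x) atTop
      (𝓝 (UnboundedOperators.heatExtension (v s) (t - s) x - oseenDuhamel 1 s v v t x)) := by
    refine (hH.sub hD).congr fun k => ?_
    exact (hmildV (k + N) (Nat.le_add_left N k)).symm
  exact tendsto_nhds_unique hL hR

end Summit.NavierStokesRegularity.NavierStokesRegularity.Theorems.BoundedPlanarEnergyRegularity

end
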